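import Summits.BirchSwinnertonDyer.BirchSwinnertonDyer.Theorems.CumulativeHeegnerLeopoldtRedSplitControlAtThreeShaTwoReadoutRoad
import Literature.NumberTheory.GaloisRepresentations.GalLayerSystemIdele
import Literature.NumberTheory.Automorphic.IdeleClassGaloisRep
import HarnessLib

/-!
# Poitou–Tate, degree two: the `Ш²`-readout road RUN on door-c4's canonical presentation — `hα` (Tate duality for
# `(Γ_K, C̄)`) and (∂) (`Ext¹(ℤ[Gal(E₀/K)]ᵐ, C̄) = 0`) DISCHARGED

Cell `bsd-wall`, seat `bsd-line-chl-p2` g6 (width prover on crux K4 `RedSplitControlAtThree`,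
stmt-BirchSwinnertonDyer-24200; stub `stub_poitouTateShaTateDual` = `poitouTate_sha_tateDual K`, item 20462).  Sequel of
`…ShaTwoReadoutRoad` (`PoitouTateShaTwoReadout.shaTwo_tateDual_of_presentation_readout`: the perfect pairing
`Ш²(K, M) × Ш¹(K, M^D) → ℤ/n` from the degree-`≤ 1` package of the presentation road + a degree-`2` obstruction map `Ψ`),
in the exact currency of door-c6 g17's `middleExact_allPlaces_tateDual_of_ideleProjection`
(`…SchneiderFreeAdditiveX3PoitouTatePresentationReadout`): the presentation is door-c4's
`FreePresentation.presentationComplex ρ₀` (`0 → N₁ → ℤ[Gal(E₀/K)]ᵐ → M₀ → 0`) of a finite `n`-torsion `ρ₀`, the module is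
`ρ := ρ₀^D`, the readout is `HomDual.readout ρ₀ n hM (π v)` for a family `π` of idèle projections, and

* `ext_presLattice_classBarD_eq_zero` — **`Ext¹_{C_Γ}(Inf ℤ[Γ/U_{E₀}]ᵐ, C̄) = 0`**: axiom I of the idèle class formation
  (`H¹(Gal(E/E₀), C_E) = 0`, `IdeleClassGroup.isZero_H1_res_galoisRep`) at every layer, through door-c6's
  `FreePresentation.ext_presLattice_eq_zero` — the input (∂) (surjectivity of `∂ : Hom(N₁, C̄) → Ext¹(M₀, C̄)`);
* **`shaTwo_tateDual_of_ideleProjection`** — `Ш²(K, M₀^D)` finite and PERFECTLY PAIRED with `Ш¹(K, M₀^{DD})` into `ℤ/n`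
  (the conclusion of `poitouTate_sha_tateDual K` at the module `ρ₀^D`, `K` totally complex) ⟸
  {`TateDualityHypotheses (classBarD K) inv` (door-c4; LANDED for `inv = classBarInvD K` as
  `IdeleClassBar.tateDualityHypotheses_classBarD_classBarInvD`), (R3) for the idèle readout (door-c5's assembly, cf.
  `exists_readout_eq_of_assembly`), an additive bijection `nat : H¹(K, M₀^{DD}) ≅ Ext¹_{C_Γ}(ℤ, M₀)` with the (R4) identity
  in EQUALITY form, the degree-`2` map `Ψ : Hom(N₁, C̄) → H²(K, M₀^D)` with its five properties, and `SelmerComplement` of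
  the canonical invariant maps at level `n` (= the output of `hE(n)`)}.

HONEST FRAMING: THEOREMS ONLY; a reduction; closes no item; no case of Poitou–Tate or BSD is proved here.

References: [MilneADT2006] I Thm. 4.10 (a) (proof, p. 58), Lemma 4.13, Thm. 1.8; [CasselsFrohlichANT1967] Ch. VII §9
Thm. 9.1; [Harari2020] Thm. 17.13 (b).
-/

noncomputable section

open Function NumberField IsDedekindDomain CategoryTheory CategoryTheory.Abelian
open scoped NumberField

set_option linter.dupNamespace false
set_option autoImplicit false

namespace Summit.BirchSwinnertonDyer.BirchSwinnertonDyer.Theorems.PoitouTateShaTwoReadout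

open Field
open Literature.NumberTheory.GaloisRepresentations Literature.NumberTheory.GaloisCohomology
open Literature.NumberTheory.GaloisRepresentations.DiscreteGaloisModule (TateDual tateDual localTatePairingZMod
  unramifiedSubgroup sha shaTwo)
open Literature.Algebra.Homology Literature.Algebra.Homology.DiscreteRep Literature.Algebra.Homology.ExtPresentation
open Literature.NumberTheory.GaloisRepresentations.IdeleClassBar (classBarD)
open Literature.AnabelianGeometry.AbsoluteAnabelian.Prop121vii (zmodToQmodZ)

/-! ## §3 The road RUN on door-c4's canonical presentation -/

section Instantiated

variable {K : Type} [Field K] [NumberField K]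

open Literature.NumberTheory.GaloisRepresentations.FreePresentation (presentationComplex presentationComplex_shortExact
  presLattice presentationLayer presentationRank ext_presLattice_eq_zero)
open Literature.NumberTheory.GaloisRepresentations.HomDual (IdeleProjection readout)
open Literature.NumberTheory.GaloisRepresentations.IdeleClassBar (GalLayer)

/-- **`Ext¹_{C_Γ}(Inf ℤ[Γ/U_{E₀}]ᵐ, C̄) = 0`** (`C̄ = lim→ C_E` = door-c5's `classBarD K`): axiom I of the idèle class
formation, `H¹(Gal(E/E₀), C_E) = 0` at every layer `E ⊇ E₀` (`IdeleClassGroup.isZero_H1_res_galoisRep`), through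
door-c6's `FreePresentation.ext_presLattice_eq_zero`.  Gives the surjectivity of the boundary
`∂ : Hom(N₁, C̄) → Ext¹(N, C̄)` for door-c4's free presentation (`ExtPresentation.boundary_surjective`).
[cite: CasselsFrohlichANT1967, Ch. VII §9 Thm. 9.1][cite: MilneADT2006, I Lemma 4.13 (proof)] -/
theorem ext_presLattice_classBarD_eq_zero (E₀ : GalLayer K) (m : ℕ)
    (x : Abelian.Ext (presLattice E₀ m) (classBarD K) 1) : x = 0 :=
  ext_presLattice_eq_zero E₀ m (classData K) 1 (fun E h₀ => by
    haveI := E.numberField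
    haveI := E.isGalois
    exact Literature.NumberTheory.Automorphic.IdeleClassGroup.isZero_H1_res_galoisRep (F := K) (E := E.1)
      (FreePresentation.layerHom E₀ h₀).ker) x

/-- **The `Ш²`-readout road on the canonical presentation.**  For a finite `n`-torsion `ρ₀` on `M₀` with door-c4's
presentation `S = presentationComplex ρ₀` (`0 → N₁ → ℤ[Gal(E₀/K)]ᵐ → M₀ → 0`), the module `ρ := ρ₀^D`, the idèle readout
`R_v := HomDual.readout ρ₀ n hM (π v)` of a family `π` of idèle projections, and an invariant map `inv` of `C̄` satisfying
door-c4's `TateDualityHypotheses` (so `α¹(Γ_K, M₀)` is bijective, `DiscreteRep.tateDuality_finite`; the record is landed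
as `IdeleClassBar.tateDualityHypotheses_classBarD_classBarInvD`), `Ext¹(ℤ[Gal(E₀/K)]ᵐ, C̄) = 0` being
`ext_presLattice_classBarD_eq_zero`: IF (R3) holds for the idèle readout (door-c5's assembly,
`exists_readout_eq_of_assembly`), a bridge `nat : H¹(K, M₀^{DD}) ≅ Ext¹(ℤ, M₀)` satisfies the (R4) identity, a degree-`2`
map `Ψ : Hom(N₁, C̄) → H²(K, M₀^D)` has the five properties, and the canonical invariant maps satisfy `SelmerComplement`
at level `n`, THEN (for `K` totally complex) `Ш²(K, M₀^D)` is finite and perfectly paired with `Ш¹(K, M₀^{DD})` into `ℤ/n`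
— the conclusion of `poitouTate_sha_tateDual K` at the module `ρ₀^D`.  HONEST FRAMING: a reduction; closes nothing.
[cite: MilneADT2006, Ch. I, Thm. 4.10 (a) (proof, p. 58), Lemma 4.13, Thm. 1.8][cite: Harari2020, Thm. 17.13 (b)] -/
theorem shaTwo_tateDual_of_ideleProjection [IsTotallyComplex K] {n : ℕ} [NeZero n]
    (hcomp : (LocalInvariants.canonical K n).SelmerComplement)
    (inv : Abelian.Ext (triv (Γ := absoluteGaloisGroup K) ℤ) (classBarD K) 2 →+ AddCircle (1 : ℚ))
    (hT : TateDualityHypotheses (classBarD K) inv) (π : ∀ v : Place K, IdeleProjection K v)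
    {M : Type} [AddCommGroup M] [TopologicalSpace M] [DiscreteTopology M] [Finite M] [Finite (TateDual K M n)]
    (ρ₀ : DiscreteGaloisModule K M) (hM : ∀ m : M, n • m = 0)
    (S₀ : Finset (Place K)) (hinf : ∀ w : InfinitePlace K, (Sum.inl w : Place K) ∈ S₀)
    (hS₀ : ∀ v : HeightOneSpectrum (𝓞 K), (Sum.inr v : Place K) ∉ S₀ →
      ((n : ℕ) : 𝓞 K) ∉ v.asIdeal ∧ GaloisRep.IsUnramifiedAt v (ρ₀.tateDual n))
    [Finite (sha ((ρ₀.tateDual n).tateDual n))]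
    (hR3 : ∀ T : Finset (Place K), (∀ w : InfinitePlace K, (Sum.inl w : Place K) ∈ T) →
      (∀ v : HeightOneSpectrum (𝓞 K), (Sum.inr v : Place K) ∉ T →
        ((n : ℕ) : 𝓞 K) ∉ v.asIdeal ∧ GaloisRep.IsUnramifiedAt v (ρ₀.tateDual n)) →
      ∀ t : Π v : Place K, galoisCohomology ((ρ₀.tateDual n).toLocal v) 1,
        (∀ v : HeightOneSpectrum (𝓞 K), (Sum.inr v : Place K) ∉ T →
          t (Sum.inr v) ∈ unramifiedSubgroup (GaloisRep.toLocal v (ρ₀.tateDual n)) 1) →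
        ∃ f : (presentationComplex ρ₀).X₁ ⟶ (ideleClassLimitShortComplex K).X₂,
          ∀ v : Place K, readout ρ₀ n hM (π v) f = t v)
    (nat : galoisCohomology ((ρ₀.tateDual n).tateDual n) 1 →+
      Abelian.Ext (triv (Γ := absoluteGaloisGroup K) ℤ) (presentationComplex ρ₀).X₃ 1)
    (hnat : Function.Bijective nat)
    (hR4 : ∀ f : (presentationComplex ρ₀).X₁ ⟶ (ideleClassLimitShortComplex K).X₂, ∃ Tf : Finset (Place K),
      ∀ (y : galoisCohomology ((ρ₀.tateDual n).tateDual n) 1) (T' : Finset (Place K)), Tf ⊆ T' →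
        (∀ v : HeightOneSpectrum (𝓞 K), (Sum.inr v : Place K) ∉ T' →
          galoisCohomology.localization ((ρ₀.tateDual n).tateDual n) (Sum.inr v) 1 y ∈
            unramifiedSubgroup (GaloisRep.toLocal v ((ρ₀.tateDual n).tateDual n)) 1) →
        zmodToQmodZ n (∑ v ∈ T', localTatePairingZMod (ρ₀.tateDual n) n v (LocalInvariants.canonical K n v)
          (readout ρ₀ n hM (π v) f)
          (galoisCohomology.localization ((ρ₀.tateDual n).tateDual n) v 1 y)) =
        inv ((nat y).comp (boundary (presentationComplex_shortExact ρ₀) (classBarD K)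
          (f ≫ (ideleClassLimitShortComplex K).g)) (rfl : 1 + 1 = 2)))
    (Ψ : ((presentationComplex ρ₀).X₁ ⟶ classBarD K) →+ galoisCohomology (ρ₀.tateDual n) 2)
    (hΨg : ∀ f : (presentationComplex ρ₀).X₁ ⟶ (ideleClassLimitShortComplex K).X₂,
      Ψ (f ≫ (ideleClassLimitShortComplex K).g) = 0)
    (hΨf : ∀ q : (presentationComplex ρ₀).X₂ ⟶ classBarD K, Ψ ((presentationComplex ρ₀).f ≫ q) = 0)
    (hΨker : ∀ h : (presentationComplex ρ₀).X₁ ⟶ classBarD K, Ψ h = 0 →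
      ∃ f : (presentationComplex ρ₀).X₁ ⟶ (ideleClassLimitShortComplex K).X₂, h = f ≫ (ideleClassLimitShortComplex K).g)
    (hΨsha : ∀ h : (presentationComplex ρ₀).X₁ ⟶ classBarD K, Ψ h ∈ shaTwo (ρ₀.tateDual n))
    (hΨsurj : ∀ c ∈ shaTwo (ρ₀.tateDual n), ∃ h : (presentationComplex ρ₀).X₁ ⟶ classBarD K, Ψ h = c) :
    Finite (shaTwo (ρ₀.tateDual n)) ∧
      ∃ b : shaTwo (ρ₀.tateDual n) →+ sha ((ρ₀.tateDual n).tateDual n) →+ ZMod n,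
        Function.Bijective b ∧ Function.Bijective b.flip := by
  haveI := absoluteGaloisGroup_compactSpace K
  haveI : Finite (presentationComplex ρ₀).X₃.obj.V := ‹Finite M›
  have hα : Function.Bijective
      (ExtDuality.adjointMap (P := triv (Γ := absoluteGaloisGroup K) ℤ) inv (presentationComplex ρ₀).X₃
        (rfl : 1 + 1 = 2)) :=
    (tateDuality_finite hT (presentationComplex ρ₀).X₃).2.1
  exact shaTwo_tateDual_of_presentation_readout hcomp (ρ₀.tateDual n)
    (fun Φ => DiscreteGaloisModule.TateDual.nsmul_eq_zero Φ) S₀ hinf hS₀ inv (presentationComplex_shortExact ρ₀) hα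
    (fun x => ext_presLattice_classBarD_eq_zero (presentationLayer ρ₀) (presentationRank ρ₀) x)
    (fun v => readout ρ₀ n hM (π v)) hR3 nat hnat hR4 Ψ hΨg hΨf hΨker hΨsha hΨsurj

end Instantiated


end Summit.BirchSwinnertonDyer.BirchSwinnertonDyer.Theorems.PoitouTateShaTwoReadout

end
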